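import Mathlib
import Summits.RiemannHypothesis.RiemannHypothesis.Theorems.WeilTransportDilateMellin
import HarnessLib

/-!
# The closed form of the transported polynomial seed's Mellin transform: `f̂(s) = e^{sa} D_M(s) M_S(s) − e^{−sa} M_G(s)`

Helper file (`--supports stmt-RiemannHypothesis-0098`), pure proofs.  Seat rh-explicit-weil-5 gen11 (`HOME/rh-explicit-weil-5/WEIL5-ZSIDE.md`
§1(b)); builds on `WeilTransportDilateMellin.lean` (p386458).

For an even polynomial seed `S(v) = Σ_{i ≤ J} q_i v^{2i}` on `[0,1]`, a window `[-a, a]` and `M` dilates, Connes' transport is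
`𝓔S(x) = e^{x/2} Σ_{m=1}^{M} S(m e^{x−a})`, the dilate `m` living on `[-a, a − log m]`.  Its window Mellin transform
`f̂(s) = Σ_m Σ_i q_i ∫_{-a}^{a − log m} e^{x/2} (m e^{x−a})^{2i} e^{(s−½)x} dx` is computed here in closed form
(`transportSeed_mellin_closedForm`):

  `f̂(s) = e^{sa} · (Σ_{m ≤ M} e^{−s log m}) · (Σ_i q_i/(s+2i))  −  e^{−sa} · Σ_i q_i (Σ_{m ≤ M} (m e^{−2a})^{2i})/(s+2i)`,

i.e. `e^{sa} D_M(s) M_S(s) − e^{−sa} M_G(s)` with `D_M` the `M`-th partial sum of `ζ` (`m^{−s} = e^{−s log m}`), `M_S` the Mellin transform of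
`S` on `[0,1]` and `M_G` that of the Riemann-sum polynomial `G(w) = Σ_{m ≤ M} S(m w e^{−2a})`.  No phase `m^{−s}` multiplies a quantity
that has to cancel across `m` — the structural reason the transform is insensitive to the zeros' precision (WEIL5-ZSIDE §1(e)).
Standard axioms only.
-/

set_option linter.dupNamespace false
set_option autoImplicit false

noncomputable section

open Real intervalIntegral Finset

namespace Summit.RiemannHypothesis.RiemannHypothesis.Theorems.WeilTransportFold

/-- Lower endpoint, window form: `m^k e^{−ka} · e^{−(s+k)a} = e^{−sa} · (m e^{−2a})^k`. -/
theorem endpoint_lower_window (a m : ℝ) (k : ℕ) (s : ℂ) :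
    ((m ^ k * Real.exp (-(k * a)) : ℝ) : ℂ) * Complex.exp ((s + k) * ((-a : ℝ) : ℂ))
      = Complex.exp (-(s * a)) * (((m * Real.exp (-(2 * a))) ^ k : ℝ) : ℂ) := by
  have h1 : ((m * Real.exp (-(2 * a))) ^ k : ℝ) = m ^ k * Real.exp (-(k * a)) * Real.exp (-(k * a)) := by
    rw [mul_pow, ← Real.exp_nat_mul, mul_assoc, ← Real.exp_add]; congr 1; congr 1; ring
  rw [h1]
  push_cast
  have h2 : Complex.exp ((s + ↑k) * -(↑a : ℂ)) = Complex.exp (-(s * ↑a)) * Complex.exp (-(↑k * ↑a)) := by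
    rw [← Complex.exp_add]; congr 1; ring
  rw [h2]; ring

/-- ONE DILATE, ONE MONOMIAL on its window `[-a, a − log m]` (`m > 0`, `s + k ≠ 0`):
`∫ e^{x/2}(m e^{x−a})^k e^{(s−½)x} = (e^{sa} e^{−s log m} − e^{−sa}(m e^{−2a})^k)/(s+k)`. -/
theorem integral_transportDilate_monomial_window (a m : ℝ) (hm : 0 < m) (k : ℕ) (s : ℂ) (hs : s + k ≠ 0) :
    ∫ x in (-a)..(a - Real.log m), (Real.exp (x / 2) : ℂ) * ((m * Real.exp (x - a)) ^ k : ℝ) * Complex.exp ((s - 1 / 2) * x)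
      = (Complex.exp (s * a) * Complex.exp (-(s * Real.log m))
          - Complex.exp (-(s * a)) * (((m * Real.exp (-(2 * a))) ^ k : ℝ) : ℂ)) / (s + k) := by
  rw [integral_transportDilate_monomial a m (-a) (a - Real.log m) k s hs, mul_div_assoc', mul_sub,
    endpoint_upper a m hm k s, endpoint_lower_window a m k s]

/-- THE CLOSED FORM.  For an even polynomial seed with coefficients `q 0, …, q J`, a window half-width `a`, `M` dilates and any `s` with
`s + 2i ≠ 0` (`i ≤ J`):
`Σ_{m=1}^{M} Σ_{i ≤ J} q_i ∫_{-a}^{a−log m} e^{x/2}(m e^{x−a})^{2i} e^{(s−½)x} dx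
   = e^{sa}·(Σ_m e^{−s log m})·(Σ_i q_i/(s+2i)) − e^{−sa}·Σ_i q_i (Σ_m (m e^{−2a})^{2i})/(s+2i)`. -/
theorem transportSeed_mellin_closedForm (a : ℝ) (M J : ℕ) (q : ℕ → ℝ) (s : ℂ)
    (hs : ∀ i ∈ range (J + 1), s + ((2 * i : ℕ) : ℂ) ≠ 0) :
    ∑ m ∈ Icc 1 M, ∑ i ∈ range (J + 1),
        (q i : ℂ) * ∫ x in (-a)..(a - Real.log m),
          (Real.exp (x / 2) : ℂ) * (((m : ℝ) * Real.exp (x - a)) ^ (2 * i) : ℝ) * Complex.exp ((s - 1 / 2) * x)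
      = Complex.exp (s * a) * ((∑ m ∈ Icc 1 M, Complex.exp (-(s * Real.log m)))
            * (∑ i ∈ range (J + 1), (q i : ℂ) / (s + ((2 * i : ℕ) : ℂ))))
        - Complex.exp (-(s * a)) * ∑ i ∈ range (J + 1),
            (q i : ℂ) * (∑ m ∈ Icc 1 M, ((((m : ℝ) * Real.exp (-(2 * a))) ^ (2 * i) : ℝ) : ℂ)) / (s + ((2 * i : ℕ) : ℂ)) := by
  -- per-term closed form
  have key : ∀ m ∈ Icc 1 M, ∀ i ∈ range (J + 1),
      (q i : ℂ) * ∫ x in (-a)..(a - Real.log m),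
          (Real.exp (x / 2) : ℂ) * (((m : ℝ) * Real.exp (x - a)) ^ (2 * i) : ℝ) * Complex.exp ((s - 1 / 2) * x)
        = Complex.exp (s * a) * (Complex.exp (-(s * Real.log m)) * ((q i : ℂ) / (s + ((2 * i : ℕ) : ℂ))))
          - Complex.exp (-(s * a)) * ((q i : ℂ) * ((((m : ℝ) * Real.exp (-(2 * a))) ^ (2 * i) : ℝ) : ℂ)
              / (s + ((2 * i : ℕ) : ℂ))) := by
    intro m hm i hi
    have hm1 : 0 < (m : ℝ) := by exact_mod_cast (Finset.mem_Icc.mp hm).1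
    have hne : s + ((2 * i : ℕ) : ℂ) ≠ 0 := hs i hi
    rw [integral_transportDilate_monomial_window a m hm1 (2 * i) s hne]
    field_simp
  rw [Finset.sum_congr rfl (fun m hm => Finset.sum_congr rfl (fun i hi => key m hm i hi))]
  simp_rw [Finset.sum_sub_distrib, ← Finset.mul_sum]
  have h1 : ∑ m ∈ Icc 1 M,
        (Complex.exp (-(s * Real.log m)) * ∑ i ∈ range (J + 1), (q i : ℂ) / (s + ((2 * i : ℕ) : ℂ)))
      = (∑ m ∈ Icc 1 M, Complex.exp (-(s * Real.log m)))
          * (∑ i ∈ range (J + 1), (q i : ℂ) / (s + ((2 * i : ℕ) : ℂ))) := by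
    rw [Finset.sum_mul]
  have h2 : ∑ m ∈ Icc 1 M, ∑ i ∈ range (J + 1),
        (q i : ℂ) * ((((m : ℝ) * Real.exp (-(2 * a))) ^ (2 * i) : ℝ) : ℂ) / (s + ((2 * i : ℕ) : ℂ))
      = ∑ i ∈ range (J + 1),
          (q i : ℂ) * (∑ m ∈ Icc 1 M, ((((m : ℝ) * Real.exp (-(2 * a))) ^ (2 * i) : ℝ) : ℂ)) / (s + ((2 * i : ℕ) : ℂ)) := by
    rw [Finset.sum_comm]
    refine Finset.sum_congr rfl (fun i _ => ?_)
    rw [Finset.mul_sum, Finset.sum_div]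
  rw [h1, h2]

end Summit.RiemannHypothesis.RiemannHypothesis.Theorems.WeilTransportFold

end
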